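import Mathlib.Algebra.CharZero.Infinite
import Mathlib.LinearAlgebra.Matrix.Transvection
import Literature.NumberTheory.DiophantineGeometry.GLHighestWeight
import Literature.Computability.AlgebraicComplexity.OrbitClosureWeights
import HarnessLib

/-!
# Discharged fact: the highest weights of `Sym^m` of the standard representation

`Literature.NumberTheory.DiophantineGeometry.GLHighestWeight` records as a named fact
(`hasHighestWeight_formRep_iff`, D-0014) the *sanity pin* of its conventions: over a field of
characteristic zero, the representation `formRep σ k m = Sym^m(k^σ)` of `GL σ k` (linear
substitution `X i ↦ ∑ j, g j i • X j` on forms of degree `m`) has the highest weight `χ` — i.e.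
admits a nonzero `B`-semi-invariant form of weight `χ` for the upper triangular Borel `B` — if
and only if `χ = m ε_{i₀} = (m, 0, …, 0)`, `i₀` the least index. This file proves it
(`hasHighestWeight_formRep_iff_holds`).

The direction `←` is the theorem `hasHighestWeight_formRep_single` of that file (`X_{i₀}^m` is a
highest-weight vector of weight `m ε_{i₀}`). The direction `→` is proved here by the classical
two-step argument, valid over any infinite field (`eq_single_of_mem_highestWeightSpace_formRep`):

* *torus step* (`natCast_eq_of_mem_support_of_linSubst_diagonal`,
  `coe_eq_monomial_of_mem_highestWeightSpace_formRep`): the diagonal matrix `diag(x)` multiplies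
  the monomial `X^e` by `∏ x_i^{e_i}` (`linSubst_diagonal_monomial`), so by the linear independence
  of the characters of the torus over an infinite field
  (`eq_zero_of_sum_mul_weightChar_eq_zero`) every monomial `X^e` occurring in a semi-invariant
  `v` of weight `χ` has `e = χ`; hence `v = c X^e` is a monomial and `χ = e ≥ 0`, `|e| = m`;
* *unipotent step* (`linSubst_transvection_X`, `eval_linSubst_transvection_monomial`): for
  `j ≠ i₀` the upper unitriangular transvection `u = 1 + E_{i₀ j}` (on which every weight
  character is `1`) substitutes `X_j ↦ X_j + X_{i₀}`; evaluating `u · X^e = X^e` at the point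
  `x_j = 0`, `x_i = 1 (i ≠ j)` gives `c = c · 0^{e_j}`, so `e_j = 0`. Hence `e = m ε_{i₀}`.

This is the weight computation behind Fulton–Harris, *Representation Theory*, GTM 129,
Prop. 15.15 for `λ = (m)` (`Sym^m ℂⁿ = 𝕊_{(m)}ℂⁿ` is the irreducible representation of highest
weight `m L₁`; proof: the weights of `𝕊_λ(ℂⁿ)` are read off from the monomials of the Schur
polynomial, each monomial `X^μ` of `Sym^m` spanning a one-dimensional weight space) and §15.5
(the highest-weight vector `(e₁)^{a₁}` of `Sym^{a₁} V`); the elementary form given here avoids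
irreducibility and complete reducibility and holds verbatim over any infinite field, in
particular over every field of characteristic zero as the named fact requires
(`CharZero.infinite`).

## References

* W. Fulton, J. Harris, *Representation Theory. A First Course*, GTM 129, Springer (1991),
  Prop. 15.15, §15.5. [FultonHarrisGTM129]
* R. Goodman, N. Wallach, *Symmetry, Representations, and Invariants*, GTM 255 (2009), §3.1.3
  (independence of torus characters), Cor. 3.2.3. [GoodmanWallachGTM255]
-/

open MvPolynomial Literature.Computability.AlgebraicComplexity

namespace Literature.NumberTheory.DiophantineGeometry

variable {σ k : Type*} [Fintype σ] [LinearOrder σ] [Field k]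

/-! ### Torus step: monomials of a semi-invariant form all have the same weight -/

/-- The diagonal substitution `X i ↦ d i • X i` acts on the coefficient of `X^e` by the
monomial character `∏ d_i^{e_i}` (from `linSubst_diagonal_monomial`). Fulton–Harris §15.5
(weights of `Sym^m V`). [folklore] -/
theorem coeff_linSubst_diagonal (d : σ → k) (v : MvPolynomial σ k) (e : σ →₀ ℕ) :
    coeff e (linSubst σ k (Matrix.diagonal d) v) = (∏ i, d i ^ e i) * coeff e v := by
  conv_lhs => rw [v.as_sum, map_sum]
  rw [coeff_sum]
  simp only [linSubst_diagonal_monomial, coeff_smul, coeff_monomial, smul_eq_mul]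
  rw [Finset.sum_eq_single e]
  · rw [if_pos rfl, Finsupp.prod_fintype _ _ (fun i => pow_zero (d i))]
  · intro e' _ hne
    rw [if_neg hne, mul_zero]
  · intro he
    rw [if_pos rfl, notMem_support_iff.mp he, mul_zero]

/-- **Torus step.** If a polynomial `v` is a semi-invariant of weight `χ` for the diagonal torus
of `GL σ k` (`k` infinite), then every monomial `X^e` occurring in `v` has exponent `e = χ`:
comparing the coefficient of `X^e` gives `∏ tᵢ^{eᵢ} · c_e = χ(t) · c_e` for all diagonal `t`, and
distinct characters of the torus are linearly independent
(`eq_zero_of_sum_mul_weightChar_eq_zero`). Fulton–Harris §15.5, proof of Prop. 15.15 (the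
monomials span the one-dimensional weight spaces of `Sym^m`); Goodman–Wallach §3.1.3.
[folklore] -/
theorem natCast_eq_of_mem_support_of_linSubst_diagonal [Infinite k] {v : MvPolynomial σ k}
    {χ : Weight σ}
    (hv : ∀ t : GL σ k, IsDiagonalGL t →
      linSubst σ k (t : Matrix σ σ k) v = weightChar χ t • v)
    {e : σ →₀ ℕ} (he : e ∈ v.support) : (fun i => (e i : ℤ)) = χ := by
  classical
  by_contra hne
  set ê : Weight σ := fun i => (e i : ℤ) with hê
  set c : k := coeff e v with hc
  have hc0 : c ≠ 0 := mem_support_iff.mp he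
  have hchar : ∀ t : GL σ k, IsDiagonalGL t → weightChar ê t * c = weightChar χ t * c := by
    intro t ht
    have h1 := congrArg (coeff e) (hv t ht)
    rw [coe_eq_diagonal_of_isDiagonalGL ht, coeff_linSubst_diagonal, coeff_smul,
      smul_eq_mul] at h1
    convert h1 using 2
    rw [weightChar]
    exact Finset.prod_congr rfl fun i _ => zpow_natCast _ _
  have key := eq_zero_of_sum_mul_weightChar_eq_zero {ê, χ} (fun w => if w = ê then c else -c)
    (fun t ht => ?_) ê (Finset.mem_insert_self _ _)
  · rw [if_pos rfl] at key
    exact hc0 key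
  · rw [Finset.sum_pair hne, if_pos rfl, if_neg (Ne.symm hne)]
    linear_combination hchar t ht

omit [Fintype σ] [LinearOrder σ] in
/-- Exponents are recovered from their casts to integral weights. [folklore] -/
theorem finsupp_eq_of_natCast_eq {e e' : σ →₀ ℕ}
    (h : (fun i => (e i : ℤ)) = fun i => (e' i : ℤ)) : e = e' :=
  Finsupp.ext fun i => by exact_mod_cast congrFun h i

variable {m : ℕ}

/-- The action of `formRep` on the underlying polynomial is the linear substitution
(unfolding lemma). [folklore] -/
theorem coe_formRep_apply (g : GL σ k) (v : homogeneousSubmodule σ k m) :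
    ((formRep σ k m g v : homogeneousSubmodule σ k m) : MvPolynomial σ k) =
      linSubst σ k (g : Matrix σ σ k) v :=
  rfl

/-- **A `B`-semi-invariant form is a monomial.** Over an infinite field, a nonzero form
`v ∈ Sym^m(k^σ)` on which the upper triangular Borel acts by the character of weight `χ` is
`c · X^e` for a single monomial `X^e` of degree `m`, `c ≠ 0`, and `χ = e` (torus step,
`natCast_eq_of_mem_support_of_linSubst_diagonal`). Fulton–Harris §15.5 (proof of Prop. 15.15:
the weight spaces of `Sym^m` are the lines spanned by the monomials). [folklore] -/
theorem coe_eq_monomial_of_mem_highestWeightSpace_formRep [Infinite k] {χ : Weight σ}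
    {v : homogeneousSubmodule σ k m} (hv : v ∈ highestWeightSpace (formRep σ k m) χ)
    (hv0 : v ≠ 0) :
    ∃ e : σ →₀ ℕ, (fun i => (e i : ℤ)) = χ ∧ e.degree = m ∧
      coeff e (v : MvPolynomial σ k) ≠ 0 ∧
      (v : MvPolynomial σ k) = monomial e (coeff e (v : MvPolynomial σ k)) := by
  classical
  have hv0' : (v : MvPolynomial σ k) ≠ 0 := fun h => hv0 (Subtype.ext h)
  obtain ⟨e₀, he₀⟩ := Finset.nonempty_iff_ne_empty.mpr (support_eq_empty.not.mpr hv0')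
  have hdiag : ∀ t : GL σ k, IsDiagonalGL t →
      linSubst σ k (t : Matrix σ σ k) v = weightChar χ t • (v : MvPolynomial σ k) := by
    intro t ht
    have h := congrArg Subtype.val (hv t ht.isUpperTriangular)
    rwa [coe_formRep_apply, Submodule.coe_smul] at h
  have hwt : ∀ e ∈ (v : MvPolynomial σ k).support, (fun i => (e i : ℤ)) = χ := fun e he =>
    natCast_eq_of_mem_support_of_linSubst_diagonal hdiag he
  have hsupp : (v : MvPolynomial σ k).support ⊆ {e₀} := fun e he =>
    Finset.mem_singleton.mpr
      (finsupp_eq_of_natCast_eq ((hwt e he).trans (hwt e₀ he₀).symm))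
  refine ⟨e₀, hwt e₀ he₀, ?_, mem_support_iff.mp he₀, ?_⟩
  · have hhom : (v : MvPolynomial σ k).IsHomogeneous m := (mem_homogeneousSubmodule m _).mp v.2
    rw [Finsupp.degree_apply]
    exact (hhom.degree_eq_sum_deg_support he₀).symm
  · conv_lhs => rw [(v : MvPolynomial σ k).as_sum]
    rw [Finset.sum_subset hsupp fun e _ he => by rw [notMem_support_iff.mp he, monomial_zero],
      Finset.sum_singleton]

/-! ### Unipotent step: root transvections kill all variables but `X_{i₀}` -/

section Transvection

omit [Fintype σ] in
/-- The entries of the transvection `1 + E_{a b}`: `δ_{x y} + δ_{x a} δ_{y b}` (Mathlib's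
`Matrix.transvection a b 1`). [folklore] -/
theorem transvection_one_apply (a b x y : σ) :
    Matrix.transvection a b (1 : k) x y =
      (if x = y then 1 else 0) + (if a = x ∧ b = y then 1 else 0) := by
  rw [Matrix.transvection, Matrix.add_apply, Matrix.one_apply, Matrix.single_apply]

omit [Fintype σ] in
/-- The diagonal entries of a transvection `1 + E_{a b}`, `a ≠ b`, are `1`. [folklore] -/
theorem transvection_one_apply_self {a b : σ} (h : a ≠ b) (x : σ) :
    Matrix.transvection a b (1 : k) x x = 1 := by
  rw [transvection_one_apply, if_pos rfl, if_neg, add_zero]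
  rintro ⟨rfl, rfl⟩
  exact h rfl

/-- For `a < b` an element of `GL σ k` with matrix the transvection `1 + E_{a b}` is upper
triangular, i.e. lies in the Borel subgroup (a root subgroup element). Fulton–Harris §15.1.
[folklore] -/
theorem isUpperTriangular_of_coe_eq_transvection {u : GL σ k} {a b : σ} (h : a < b)
    (hu : (u : Matrix σ σ k) = Matrix.transvection a b 1) : IsUpperTriangular u := by
  intro x y hyx
  change y < x at hyx
  rw [hu, transvection_one_apply, if_neg hyx.ne', if_neg, add_zero]
  rintro ⟨rfl, rfl⟩
  exact lt_asymm h hyx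

/-- Every weight character is `1` on a transvection (its diagonal is `1`). [folklore] -/
theorem weightChar_of_coe_eq_transvection (χ : Weight σ) {u : GL σ k} {a b : σ} (h : a ≠ b)
    (hu : (u : Matrix σ σ k) = Matrix.transvection a b 1) : weightChar χ u = 1 := by
  rw [weightChar, hu]
  exact Finset.prod_eq_one fun i _ => by rw [transvection_one_apply_self h, one_zpow]

/-- The transvection `1 + E_{a b}` substitutes `X_b ↦ X_b + X_a` and fixes the other variables
(column convention `X y ↦ ∑ x, g x y • X x` of `linSubst`). Fulton–Harris §15.1. [folklore] -/
theorem linSubst_transvection_X (a b y : σ) :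
    linSubst σ k (Matrix.transvection a b (1 : k)) (X y) = X y + if y = b then X a else 0 := by
  rw [linSubst_X]
  simp only [transvection_one_apply, add_smul, Finset.sum_add_distrib, ite_smul, one_smul,
    zero_smul, Finset.sum_ite_eq', Finset.mem_univ, if_true]
  congr 1
  by_cases hy : y = b
  · subst hy
    rw [if_pos rfl, Finset.sum_eq_single a]
    · rw [if_pos ⟨rfl, rfl⟩]
    · intro x _ hx
      rw [if_neg fun h' => hx h'.1.symm]
    · intro ha
      exact absurd (Finset.mem_univ a) ha
  · rw [if_neg hy]
    exact Finset.sum_eq_zero fun x _ => if_neg fun h' => hy h'.2.symm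

/-- **Unipotent step (evaluation form).** Evaluating `(1 + E_{a b}) · (c X^e)` (`a ≠ b`) at the
point `x_b = 0`, `x_i = 1 (i ≠ b)` gives `c`: every substituted variable evaluates to `1` there.
[folklore] -/
theorem eval_linSubst_transvection_monomial {a b : σ} (h : a ≠ b) (e : σ →₀ ℕ) (c : k) :
    eval (fun i => if i = b then (0 : k) else 1)
        (linSubst σ k (Matrix.transvection a b (1 : k)) (monomial e c)) = c := by
  have hX : ∀ y, eval (fun i => if i = b then (0 : k) else 1)
      (linSubst σ k (Matrix.transvection a b (1 : k)) (X y)) = 1 := by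
    intro y
    rw [linSubst_transvection_X, map_add, eval_X]
    by_cases hy : y = b
    · rw [if_pos hy, if_pos hy, eval_X, if_neg h, zero_add]
    · rw [if_neg hy, if_neg hy, map_zero, add_zero]
  have key : eval (fun i => if i = b then (0 : k) else 1)
      (linSubst σ k (Matrix.transvection a b (1 : k)) (monomial e c)) =
      eval (fun y => eval (fun i => if i = b then (0 : k) else 1)
        (linSubst σ k (Matrix.transvection a b (1 : k)) (X y))) (monomial e c) := by
    simp only [linSubst_X]
    exact eval₂Hom_bind₁ _ _ _ _
  rw [key]
  simp only [hX, eval_monomial, one_pow, Finsupp.prod, Finset.prod_const_one, mul_one]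

omit [Fintype σ] in
/-- The monomial `c X^e` vanishes at the point `x_b = 0`, `x_i = 1 (i ≠ b)` as soon as `X_b`
occurs in it. [folklore] -/
theorem eval_monomial_eq_zero_of_ne_zero {b : σ} {e : σ →₀ ℕ} (he : e b ≠ 0) (c : k) :
    eval (fun i => if i = b then (0 : k) else 1) (monomial e c) = 0 := by
  classical
  rw [eval_monomial, Finsupp.prod, Finset.prod_eq_zero (Finsupp.mem_support_iff.mpr he),
    mul_zero]
  rw [if_pos rfl, zero_pow he]

end Transvection

/-! ### The highest weights of `Sym^m` -/

/-- **The only highest weight of `Sym^m(k^σ)` is `m ε_{i₀}`** (`k` infinite, `i₀` the least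
index): a nonzero `B`-semi-invariant form of weight `χ` is a monomial `c X^e` with `χ = e`
(`coe_eq_monomial_of_mem_highestWeightSpace_formRep`), and invariance under the transvections
`X_j ↦ X_j + X_{i₀}` (`j ≠ i₀`), evaluated at `x_j = 0`, `x_i = 1 (i ≠ j)`, forces `e_j = 0`;
with `|e| = m` this gives `e = m ε_{i₀}`. Fulton–Harris Prop. 15.15 (`λ = (m)`), §15.5.
[folklore] -/
theorem eq_single_of_mem_highestWeightSpace_formRep [Infinite k] {χ : Weight σ}
    {v : homogeneousSubmodule σ k m} (hv : v ∈ highestWeightSpace (formRep σ k m) χ)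
    (hv0 : v ≠ 0) (i₀ : σ) (hi₀ : ∀ i, i₀ ≤ i) : χ = Pi.single i₀ (m : ℤ) := by
  classical
  obtain ⟨e, heχ, hdeg, hc, hve⟩ := coe_eq_monomial_of_mem_highestWeightSpace_formRep hv hv0
  -- unipotent step: `e j = 0` for `j ≠ i₀`
  have hej : ∀ j, j ≠ i₀ → e j = 0 := by
    intro j hj
    have hlt : i₀ < j := (hi₀ j).lt_of_ne (Ne.symm hj)
    by_contra hne
    -- the root-group element `u = 1 + E_{i₀ j} ∈ B`
    set u : GL σ k := Matrix.GeneralLinearGroup.mkOfDetNeZero (Matrix.transvection i₀ j (1 : k))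
      (by rw [Matrix.det_transvection_of_ne i₀ j hlt.ne]; exact one_ne_zero)
    have hu : (u : Matrix σ σ k) = Matrix.transvection i₀ j 1 :=
      Matrix.GeneralLinearGroup.val_mkOfDetNeZero _ _
    have h := congrArg Subtype.val (hv u (isUpperTriangular_of_coe_eq_transvection hlt hu))
    rw [coe_formRep_apply, Submodule.coe_smul, weightChar_of_coe_eq_transvection χ hlt.ne hu,
      one_smul, hve, hu] at h
    have h' := congrArg (eval fun i => if i = j then (0 : k) else 1) h
    rw [eval_linSubst_transvection_monomial hlt.ne, eval_monomial_eq_zero_of_ne_zero hne] at h'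
    exact hc h'
  -- degree count: `e i₀ = m`
  have hei₀ : e i₀ = m := by
    rw [← hdeg, Finsupp.degree_eq_sum, Finset.sum_eq_single i₀ (fun j _ hj => hej j hj)
      (fun h => absurd (Finset.mem_univ i₀) h)]
  rw [← heχ]
  funext i
  by_cases hi : i = i₀
  · subst hi
    rw [Pi.single_eq_same, hei₀]
  · rw [Pi.single_eq_of_ne hi, hej i hi, Nat.cast_zero]

/-- **Discharge of `hasHighestWeight_formRep_iff`** (`GLHighestWeight.lean`): over a field of
characteristic zero, `Sym^m(k^σ)` (`formRep σ k m`) has the highest weight `χ` iff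
`χ = m ε_{i₀}`, `i₀` the least index. `←`: `hasHighestWeight_formRep_single`; `→`:
`eq_single_of_mem_highestWeightSpace_formRep` (a field of characteristic zero is infinite,
`CharZero.infinite`). Fulton–Harris Prop. 15.15 with `λ = (m)` (`Sym^m ℂⁿ` is the irreducible
representation of highest weight `m L₁`) and §15.5; Goodman–Wallach Cor. 3.2.3.
[cite: FultonHarrisGTM129, Prop. 15.15 (λ = (m)), §15.5] -/
theorem hasHighestWeight_formRep_iff_holds :
    hasHighestWeight_formRep_iff (σ := σ) (k := k) := by
  intro _ m χ i₀ hi₀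
  constructor
  · intro h
    obtain ⟨v, hv0, hv⟩ := (hasHighestWeight_iff_exists _ _).mp h
    exact eq_single_of_mem_highestWeightSpace_formRep hv hv0 i₀ hi₀
  · rintro rfl
    exact hasHighestWeight_formRep_single m i₀ hi₀

end Literature.NumberTheory.DiophantineGeometry
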